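import Literature.Computability.MetaComplexity.AvgCaseHardEFromPromiseBPP
import Literature.Computability.MetaComplexity.SearchHeuristicSchemesHardE
import Literature.Computability.MetaComplexity.UniversalHeuristicSchemes
import HarnessLib

/-!
# Hirahara 2021, Thm. 4.2, Thm. 8.9, Cor. 8.12 and Lemma 2.2 (1) from the PROMISE form of Lemma 3.4 alone

Topic `Literature/Computability/MetaComplexity`, a short assembly file. `LanguageCompressionHardE.lean`
and `SearchHeuristicSchemesHardE.lean` reduced the named facts `Hirahara2021_languageCompression`
(Thm. 4.2) and `Hirahara2021_UP_searchUHS_of_Avg1P` (Thm. 8.9 for `UP`-type verifiers) to ONE leaf —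
*Hirahara's hypothesis `coNP × {U, T} ⊆ Avg¹_{1-n^{-c}} P` yields a `2^{εn}`-hard language in `E`*
(items 1–3 of the proof sketch of Lemma 3.4, ECCC TR21-058, p. 20). By
`AvgCaseHardEFromPromiseBPP.lean` that leaf follows from the PROMISE form of Lemma 3.4, i.e. from
`coNP × {U, T} ⊆ Avg¹_{1-n^{-c}} P ⟹ pr-BPP = pr-P` (the Köbler–Schuler certifier made into an explicit
construction of certified hard tables by the derandomised greedy search, Goldreich 2011, Thm. 3.5).
Hence:

* `Hirahara2021_languageCompression_of_promiseLemma34` — Thm. 4.2 from `hyp → PromiseBPP' ⊆ PromiseP`;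
* `Hirahara2021_UP_searchUHS_of_Avg1P_of_promiseLemma34`, `Hirahara2021_UP_hasUHS_of_Avg1P_of_promiseLemma34`
  — Thm. 8.9 and Cor. 8.12 for `UP` from the same;
* `Hirahara2021_hasUHS_of_mem_UP_of_PromiseBPP'_subset` — Lemma 2.2 (1) (the named fact
  `Hirahara2021_hasUHS_of_mem_UP`, hypothesis `DistNP ⊆ AvgP`) from Buhrman–Fortnow–Pavan's Thm. 3.1
  (the named fact `BuhrmanFortnowPavan2004_PromiseBPP'_subset_PromiseP`) alone.

So all four named facts of the Hirahara line (`Hirahara2021_languageCompression`,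
`Hirahara2021_UP_searchUHS_of_Avg1P`, `Hirahara2021_hasUHS_of_mem_UP`, and Thm. 1.6 (1)
`Cryptography.hirahara_UP_DistNP`, see `Cryptography/AverageCaseProofs.lean`) rest on the single
statement "the average-case hypothesis gives `pr-BPP = pr-P`" (Lemma 3.4 in promise form, resp. BFP
Thm. 3.1), whose printed proofs pass through BFP's Lemma 3.7. No definition, no named fact (D-0026).

## References

* S. Hirahara, *Average-case hardness of NP from exponential worst-case hardness assumptions*,
  ECCC TR21-058 (2021): Lemma 2.2 (1), Lemma 3.4 (proof sketch, p. 20), Thm. 4.2, Thm. 8.9, Cor. 8.12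
  [Hirahara2021].
* H. Buhrman, L. Fortnow, A. Pavan, *Some results on derandomization*, Theory Comput. Syst. 38 (2005),
  Thm. 3.1 [BuhrmanFortnowPavan2004].
* O. Goldreich, *In a world of P = BPP*, LNCS 6650 (2011), §3.2, Thm. 3.5 (reducing BPP-search to
  decision) and §3.3, Prop. 3.8 (derandomizing constructions: "if BPP = P, then n-bit long primes can be
  found in deterministic poly(n)-time") [Goldreich2011].
-/

namespace Literature.Computability.MetaComplexity

open _root_.Computability Complexity Complexity.Classes Complexity.Nondeterministic Filter

/-- **Hirahara 2021, Thm. 4.2 from the promise form of Lemma 3.4.** If Hirahara's hypothesis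
`coNP × {U, T} ⊆ Avg¹_{1-n^{-c}} P` implies `PromiseBPP' ⊆ PromiseP`, then
`Hirahara2021_languageCompression` holds: the hypothesis then yields a `2^{εn}`-hard language in `E`
(`HardEFromCert.Hirahara2021_hardE_of_Avg1P_of_PromiseBPP'_subset`), which is the one leaf of
`Hirahara2021_languageCompression_of_hardE`. [cite: Hirahara2021, Thm. 4.2 and Lemma 3.4 (proof sketch, p. 20)] -/
theorem Hirahara2021_languageCompression_of_promiseLemma34
    (h34 : (∃ c : ℕ, distClass coNP {uniformEnsemble, tallyEnsemble} ⊆ Avg1DeltaP fun n => 1 - 1 / (n : ℝ) ^ c) →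
      PromiseBPP' ⊆ PromiseP) :
    Hirahara2021_languageCompression :=
  Hirahara2021_languageCompression_of_hardE fun hyp =>
    HardEFromCert.Hirahara2021_hardE_of_Avg1P_of_PromiseBPP'_subset hyp (h34 hyp)

/-- **Hirahara 2021, Thm. 8.9 (`UP` form) from the promise form of Lemma 3.4.**
[cite: Hirahara2021, Thm. 8.9 and Lemma 3.4 (proof sketch, p. 20)] -/
theorem Hirahara2021_UP_searchUHS_of_Avg1P_of_promiseLemma34
    (h34 : (∃ c : ℕ, distClass coNP {uniformEnsemble, tallyEnsemble} ⊆ Avg1DeltaP fun n => 1 - 1 / (n : ℝ) ^ c) →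
      PromiseBPP' ⊆ PromiseP) :
    Hirahara2021_UP_searchUHS_of_Avg1P :=
  Hirahara2021_UP_searchUHS_of_Avg1P_of_hardE fun hyp =>
    HardEFromCert.Hirahara2021_hardE_of_Avg1P_of_PromiseBPP'_subset hyp (h34 hyp)

/-- **Hirahara 2021, Cor. 8.12 for `UP` from the promise form of Lemma 3.4**: every `L ∈ UP` admits a
universal heuristic scheme under Hirahara's hypothesis. [cite: Hirahara2021, Cor. 8.12 and Lemma 3.4 (proof sketch, p. 20)] -/
theorem Hirahara2021_UP_hasUHS_of_Avg1P_of_promiseLemma34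
    (h34 : (∃ c : ℕ, distClass coNP {uniformEnsemble, tallyEnsemble} ⊆ Avg1DeltaP fun n => 1 - 1 / (n : ℝ) ^ c) →
      PromiseBPP' ⊆ PromiseP) :
    ∀ U : UniversalMachine,
      (∃ c : ℕ, distClass coNP {uniformEnsemble, tallyEnsemble} ⊆ Avg1DeltaP fun n => 1 - 1 / (n : ℝ) ^ c) →
      ∀ L ∈ UP, U.HasUniversalHeuristicScheme L :=
  Hirahara2021_UP_hasUHS_of_Avg1P_of_hardE fun hyp =>
    HardEFromCert.Hirahara2021_hardE_of_Avg1P_of_PromiseBPP'_subset hyp (h34 hyp)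

/-- **Hirahara 2021, Lemma 2.2 (1) (the named fact `Hirahara2021_hasUHS_of_mem_UP`) from
Buhrman–Fortnow–Pavan's Thm. 3.1 alone.** Under `DistNP ⊆ AvgP`, Hirahara's hypothesis holds with `c = 1`
(`distClass_coNP_subset_Avg1DeltaP_of_DistNP_subset_AvgP`, p. 9) and `pr-BPP = pr-P` by the named fact
`BuhrmanFortnowPavan2004_PromiseBPP'_subset_PromiseP`; the hard language in `E` follows
(`HardEFromCert.exists_hard_E_of_DistNP_subset_AvgP_of_PromiseBPP'_subset`) and Cor. 8.12 for `UP`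
applies. [cite: Hirahara2021, Lemma 2.2 (1) and Thm. 11.1 (p. 51)] [cite: BuhrmanFortnowPavan2004, Thm. 3.1] -/
theorem Hirahara2021_hasUHS_of_mem_UP_of_PromiseBPP'_subset
    (hBFP : BuhrmanFortnowPavan2004_PromiseBPP'_subset_PromiseP) : Hirahara2021_hasUHS_of_mem_UP :=
  fun U hD L hL =>
    Hirahara2021_UP_hasUHS_of_Avg1P_of_hardE
      (fun _ => HardEFromCert.exists_hard_E_of_DistNP_subset_AvgP_of_PromiseBPP'_subset hD (hBFP hD)) U
      ⟨1, distClass_coNP_subset_Avg1DeltaP_of_DistNP_subset_AvgP hD one_ne_zero⟩ L hL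

end Literature.Computability.MetaComplexity
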